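import Mathlib.Combinatorics.Young.YoungDiagram
import Mathlib.Data.Fintype.BigOperators
import Mathlib.SetTheory.Cardinal.Finite
import Mathlib.Data.Fin.Tuple.Basic
import Mathlib.Data.Fin.SuccPred
import Literature.NumberTheory.DiophantineGeometry.PartitionTableaux
import HarnessLib

/-!
# Standard fillings of Young diagrams and their branching rule
(trunk ArithGeomL / CplxAlg; combinatorial infrastructure for the proof of
`hwMultiplicity_glTensorRep`)

A *standard filling* of a Young diagram `Y` by `0, …, n-1` is an injective map
`f : Fin n → ℕ × ℕ` into the cells of `Y` such that a larger entry never lies weakly north-west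
of a smaller one (entries increase along rows and down columns); when `n = |Y|` these are the
standard Young tableaux of shape `Y` and, for `Y = μ.youngDiagram`, `numStandardTableaux μ`
counts them (`numStandardTableaux_eq_card_stdFilling`).

The main result of this file is the **branching rule** in the form
`#Std_{n+1}(Y) = ∑_{c ∈ Y} #Std_n(Y ⊖ c)` (`card_stdFilling_succ`), where
`Y ⊖ c = Y.removeAbove c` is the Young diagram of cells of `Y` not weakly south-east of `c`
(the largest entry `n` of a standard filling sits in some cell `c`, and the remaining entries
avoid the cells `≥ c`). For a *corner* `c` of `Y` (a cell in a row strictly longer than the next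
row, `Y.removeAbove c = Y ∖ {c}`, `removeAbove_corner_eq_erase`) this is the removal of one
box; for other cells `Y ⊖ c` has fewer than `|Y| - 1` cells and contributes nothing when
`n + 1 = |Y|`. We also record the row lengths of `Y ∖ {corner}` and that a standard Young
tableau is determined by the rows of its entries (`StdFilling.ext_of_row_eq`).

## Sources

* W. Fulton, *Young Tableaux*, LMS Student Texts 35 (1997), §7.2 (standard tableaux, `f^λ`),
  §4.3 / §5.1 Ex. 3 (branching `f^λ = ∑ f^{λ⁻}` over the corners of `λ`).
* G. D. James, *The Representation Theory of the Symmetric Groups*, LNM 682 (1978), §3, §9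
  (branching theorem, 9.2).

## Mathlib

Uses `YoungDiagram` (`row`, `rowLen`, `mem_iff_lt_rowLen`, `rowLen_eq_card`, `rowLen_anti`),
`Equiv.sigmaFiberEquiv`, `Nat.card_sigma`, `Fin.snoc`/`Fin.castSucc`. Mathlib has
`SemistandardYoungTableau` but (grep at this pin) no standard Young tableaux and no branching
rule; `IsStandardFilling`/`numStandardTableaux` are H21's (`PartitionTableaux`).

## Design

* `YoungDiagram.removeAbove` is declared in Mathlib's `YoungDiagram` namespace for dot notation
  (H21 convention: deliberate extension; the name does not exist in Mathlib). It needs no corner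
  hypothesis: removing the principal upper set of any cell from a lower set leaves a lower set.
* `StdFilling n Y` uses plain functions `Fin n → ℕ × ℕ` (membership in `Y` is part of the
  predicate `IsStdFilling`), so that restriction and extension along the last entry are just
  `f ∘ Fin.castSucc` and `Fin.snoc f c`. It is a finite type; statements use `Nat.card`.
* The order condition `¬ (f q ≤ f p)` for `p < q` is the product order on `ℕ × ℕ`, literally the
  condition of `IsStandardFilling`.
-/

namespace Literature.NumberTheory.DiophantineGeometry

open YoungDiagram

/-! ### Removing the cells weakly south-east of a cell -/

/-- `Y.removeAbove c`: the Young diagram of the cells of `Y` that are **not** weakly south-east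
of `c` (i.e. not `≥ c` in the product order). For a corner `c` this is `Y` with the box `c`
removed (`removeAbove_corner_eq_erase`). Declared in Mathlib's `YoungDiagram` namespace for dot
notation (H21 convention: deliberate extension). Fulton, *Young Tableaux*, §7.2 (removing the box
of the largest entry). [folklore] -/
def _root_.YoungDiagram.removeAbove (Y : YoungDiagram) (c : ℕ × ℕ) : YoungDiagram where
  cells := Y.cells.filter fun x => ¬ c ≤ x
  isLowerSet := by
    intro x y hyx hx
    have hx' := Finset.mem_filter.1 (Finset.mem_coe.1 hx)
    exact Finset.mem_coe.2 (Finset.mem_filter.2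
      ⟨Y.isLowerSet hyx hx'.1, fun h => hx'.2 (h.trans hyx)⟩)

/-- Membership in `Y.removeAbove c` (unfolding lemma). [folklore] -/
@[simp]
theorem _root_.YoungDiagram.mem_removeAbove {Y : YoungDiagram} {c x : ℕ × ℕ} :
    x ∈ Y.removeAbove c ↔ x ∈ Y ∧ ¬ c ≤ x := by
  change x ∈ Y.cells.filter _ ↔ _
  simp

/-- The cells of `Y.removeAbove c` (unfolding lemma). [folklore] -/
theorem _root_.YoungDiagram.removeAbove_cells (Y : YoungDiagram) (c : ℕ × ℕ) :
    (Y.removeAbove c).cells = Y.cells.filter fun x => ¬ c ≤ x :=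
  rfl

/-- `Y.removeAbove c` is contained in `Y`. [folklore] -/
theorem _root_.YoungDiagram.mem_of_mem_removeAbove {Y : YoungDiagram} {c x : ℕ × ℕ}
    (h : x ∈ Y.removeAbove c) : x ∈ Y :=
  (YoungDiagram.mem_removeAbove.1 h).1

/-- A row length is determined by the membership of the cells of that row. [folklore] -/
theorem _root_.YoungDiagram.rowLen_eq_of_forall_mem_iff {Y : YoungDiagram} {i L : ℕ}
    (h : ∀ j, (i, j) ∈ Y ↔ j < L) : Y.rowLen i = L := by
  have h₁ : ¬ Y.rowLen i < L := fun hlt =>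
    lt_irrefl _ (YoungDiagram.mem_iff_lt_rowLen.1 ((h _).2 hlt))
  have h₂ : ¬ L < Y.rowLen i := fun hlt =>
    lt_irrefl _ ((h _).1 (YoungDiagram.mem_iff_lt_rowLen.2 hlt))
  omega

/-- The row below the last possible row is empty: if every cell of `Y` has row index `< N` then
`Y.rowLen N = 0`. [folklore] -/
theorem _root_.YoungDiagram.rowLen_eq_zero_of_forall_lt {Y : YoungDiagram} {N : ℕ}
    (hY : ∀ x ∈ Y.cells, x.1 < N) : Y.rowLen N = 0 :=
  YoungDiagram.rowLen_eq_of_forall_mem_iff fun _ =>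
    ⟨fun h => absurd (hY _ h) (lt_irrefl _), fun h => absurd h (Nat.not_lt_zero _)⟩

section Corner

variable {Y : YoungDiagram} {r : ℕ}

/-- The cells of `Y` weakly south-east of the last cell `(r, rowLen r - 1)` of a row that is
strictly longer than the next row consist of that cell only (it is a *corner*).
Fulton, *Young Tableaux*, §7.2 (outside corners). [folklore] -/
theorem _root_.YoungDiagram.corner_le_iff (h : Y.rowLen (r + 1) < Y.rowLen r) {x : ℕ × ℕ}
    (hx : x ∈ Y) : (r, Y.rowLen r - 1) ≤ x ↔ x = (r, Y.rowLen r - 1) := by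
  obtain ⟨i, j⟩ := x
  constructor
  · intro hle
    obtain ⟨hi, hj⟩ := Prod.mk_le_mk.1 hle
    have hjlt : j < Y.rowLen i := YoungDiagram.mem_iff_lt_rowLen.1 hx
    rcases hi.eq_or_lt with rfl | hlt
    · simp only [Prod.mk.injEq, true_and]
      omega
    · have := Y.rowLen_anti (r + 1) i hlt
      omega
  · rintro h
    rw [h]

/-- For a corner, `removeAbove` removes exactly the corner box.
Fulton, *Young Tableaux*, §7.2. [folklore] -/
theorem _root_.YoungDiagram.removeAbove_corner_eq_erase (h : Y.rowLen (r + 1) < Y.rowLen r) :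
    (Y.removeAbove (r, Y.rowLen r - 1)).cells = Y.cells.erase (r, Y.rowLen r - 1) := by
  ext x
  rw [YoungDiagram.removeAbove_cells, Finset.mem_filter, Finset.mem_erase]
  constructor
  · rintro ⟨hx, hnle⟩
    exact ⟨fun heq => hnle (heq ▸ le_rfl), hx⟩
  · rintro ⟨hne, hx⟩
    exact ⟨hx, fun hle => hne ((YoungDiagram.corner_le_iff h hx).1 hle)⟩

/-- Removing a corner box lowers the number of cells by one. Fulton, *Young Tableaux*, §7.2.
[folklore] -/
theorem _root_.YoungDiagram.card_removeAbove_corner (h : Y.rowLen (r + 1) < Y.rowLen r) :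
    (Y.removeAbove (r, Y.rowLen r - 1)).cells.card = Y.cells.card - 1 := by
  rw [YoungDiagram.removeAbove_corner_eq_erase h, Finset.card_erase_of_mem]
  exact (YoungDiagram.mem_cells _).2 (YoungDiagram.mem_iff_lt_rowLen.2 (by omega))

/-- Removing the corner box of row `r` shortens row `r` by one. Fulton, *Young Tableaux*, §7.2.
[folklore] -/
theorem _root_.YoungDiagram.rowLen_removeAbove_corner_self (h : Y.rowLen (r + 1) < Y.rowLen r) :
    (Y.removeAbove (r, Y.rowLen r - 1)).rowLen r = Y.rowLen r - 1 := by
  refine YoungDiagram.rowLen_eq_of_forall_mem_iff fun j => ?_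
  rw [YoungDiagram.mem_removeAbove, YoungDiagram.mem_iff_lt_rowLen, Prod.mk_le_mk]
  omega

/-- Removing the corner box of row `r` does not change the other rows.
Fulton, *Young Tableaux*, §7.2. [folklore] -/
theorem _root_.YoungDiagram.rowLen_removeAbove_corner_of_ne (h : Y.rowLen (r + 1) < Y.rowLen r)
    {i : ℕ} (hi : i ≠ r) : (Y.removeAbove (r, Y.rowLen r - 1)).rowLen i = Y.rowLen i := by
  refine YoungDiagram.rowLen_eq_of_forall_mem_iff fun j => ?_
  rw [YoungDiagram.mem_removeAbove, YoungDiagram.mem_iff_lt_rowLen, Prod.mk_le_mk]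
  constructor
  · exact fun h' => h'.1
  · intro hj
    refine ⟨hj, fun ⟨hri, hrj⟩ => ?_⟩
    have hlt : r < i := lt_of_le_of_ne hri (Ne.symm hi)
    have := Y.rowLen_anti (r + 1) i hlt
    omega

end Corner

/-! ### Standard fillings -/

section CplxAlg

/-- A map `f : Fin n → ℕ × ℕ` is a *standard filling* of the Young diagram `Y` by `0, …, n-1`
if it takes values in the cells of `Y`, is injective, and a larger entry never lies weakly
north-west of a smaller one (the entries increase along rows and down columns). For `n = |Y|`
these are the standard Young tableaux of shape `Y` (`IsStandardFilling`).
Fulton, *Young Tableaux*, §7.2; James, LNM 682, §3. [folklore] -/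
def IsStdFilling (n : ℕ) (Y : YoungDiagram) (f : Fin n → ℕ × ℕ) : Prop :=
  (∀ p, f p ∈ Y) ∧ Function.Injective f ∧ ∀ p q : Fin n, p < q → ¬ (f q ≤ f p)

/-- The type of standard fillings of `Y` by `0, …, n-1` (a finite type; empty unless `n ≤ |Y|`,
and for `n = |Y|` the standard Young tableaux of shape `Y`). Fulton, *Young Tableaux*, §7.2.
[folklore] -/
def StdFilling (n : ℕ) (Y : YoungDiagram) : Type :=
  {f : Fin n → ℕ × ℕ // IsStdFilling n Y f}

namespace StdFilling

variable {n : ℕ} {Y : YoungDiagram}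

/-- The entries of a standard filling lie in the diagram. [folklore] -/
theorem mem (T : StdFilling n Y) (p : Fin n) : T.1 p ∈ Y :=
  T.2.1 p

/-- A standard filling is injective. [folklore] -/
theorem injective (T : StdFilling n Y) : Function.Injective T.1 :=
  T.2.2.1

/-- In a standard filling a larger entry is never weakly north-west of a smaller one.
[folklore] -/
theorem not_le (T : StdFilling n Y) {p q : Fin n} (h : p < q) : ¬ (T.1 q ≤ T.1 p) :=
  T.2.2.2 p q h

/-- Two standard fillings with the same underlying map are equal. [folklore] -/
@[ext]
theorem ext {T T' : StdFilling n Y} (h : T.1 = T'.1) : T = T' :=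
  Subtype.ext h

/-- In a standard filling the entries of a column increase downwards: for `p < q` in the same
column, `p` lies in a strictly higher row. Fulton, *Young Tableaux*, §7.2. [folklore] -/
theorem row_lt_row_of_lt (T : StdFilling n Y) {p q : Fin n} (h : p < q)
    (hcol : (T.1 p).2 = (T.1 q).2) : (T.1 p).1 < (T.1 q).1 := by
  by_contra hle
  exact T.not_le h (Prod.mk_le_mk.2 ⟨not_lt.1 hle, hcol.symm.le⟩)

/-- In a standard filling the entries of a row increase to the right: for `p < q` in the same
row, `p` lies in a strictly smaller column. Fulton, *Young Tableaux*, §7.2. [folklore] -/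
theorem col_lt_col_of_lt (T : StdFilling n Y) {p q : Fin n} (h : p < q)
    (hrow : (T.1 p).1 = (T.1 q).1) : (T.1 p).2 < (T.1 q).2 := by
  by_contra hle
  exact T.not_le h (Prod.mk_le_mk.2 ⟨hrow.symm.le, not_lt.1 hle⟩)

/-- Standard fillings form a finite type (they embed into `Fin n → Y.cells`). [folklore] -/
instance finite : Finite (StdFilling n Y) := by
  classical
  refine Finite.of_injective
    (fun T : StdFilling n Y => fun p => (⟨T.1 p, (YoungDiagram.mem_cells _).2 (T.mem p)⟩ : Y.cells))
    fun T T' h => ?_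
  ext p : 2
  exact congrArg Subtype.val (congrFun h p)

/-- The `Fintype` structure on standard fillings (from finiteness). [folklore] -/
noncomputable instance fintype : Fintype (StdFilling n Y) :=
  Fintype.ofFinite _

/-- A standard filling by `n = |Y|` entries is a bijection onto the cells of `Y`.
Fulton, *Young Tableaux*, §7.2. [folklore] -/
theorem bijective (T : StdFilling n Y) (hn : Y.cells.card = n) :
    Function.Bijective
      (fun p => (⟨T.1 p, (YoungDiagram.mem_cells _).2 (T.mem p)⟩ : Y.cells)) := by
  rw [Fintype.bijective_iff_injective_and_card]
  refine ⟨fun p q h => T.injective (congrArg Subtype.val h), ?_⟩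
  simp [hn]

/-- A standard filling by `n = |Y|` entries hits every cell. Fulton, *Young Tableaux*, §7.2.
[folklore] -/
theorem exists_eq (T : StdFilling n Y) (hn : Y.cells.card = n) {x : ℕ × ℕ} (hx : x ∈ Y) :
    ∃ p, T.1 p = x := by
  obtain ⟨p, hp⟩ := (T.bijective hn).2 ⟨x, (YoungDiagram.mem_cells _).2 hx⟩
  exact ⟨p, congrArg Subtype.val hp⟩

/-- **A standard Young tableau is determined by the rows of its entries** (its "row word"):
two standard fillings by `n = |Y|` entries placing every entry in the same row are equal.
(At the least entry `p` where they differ, the cell of `p` in one tableau carries, in the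
other, an entry `q > p` in the same row and a weakly smaller column — impossible.)
James, LNM 682, §3 (3.6: a standard tableau is determined by its tabloid); Fulton,
*Young Tableaux*, §7.2. [folklore] -/
theorem ext_of_row_eq {T T' : StdFilling n Y} (hn : Y.cells.card = n)
    (h : ∀ p, (T.1 p).1 = (T'.1 p).1) : T = T' := by
  -- by strong induction on the entry
  suffices key : ∀ (v : ℕ) (p : Fin n), (p : ℕ) = v → T.1 p = T'.1 p by
    ext p : 2
    exact key _ p rfl
  intro v
  induction v using Nat.strong_induction_on with
  | _ v ih =>
    rintro p rfl
    -- a general argument, applied to `(T, T')` and to `(T', T)`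
    have main : ∀ {S S' : StdFilling n Y}, (∀ q : Fin n, (q : ℕ) < p → S.1 q = S'.1 q) →
        (S.1 p).1 = (S'.1 p).1 → ¬ (S.1 p).2 < (S'.1 p).2 := by
      intro S S' hS hrow hlt
      obtain ⟨q, hq⟩ := S'.exists_eq hn (S.mem p)
      rcases lt_trichotomy q p with hqp | rfl | hpq
      · have := hS q hqp
        rw [← this] at hq
        exact absurd (S.injective hq) (ne_of_lt hqp)
      · exact absurd (congrArg Prod.snd hq) (ne_of_gt hlt)
      · apply S'.not_le hpq
        rw [hq]
        exact Prod.mk_le_mk.2 ⟨hrow.le, hlt.le⟩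
    have hS : ∀ q : Fin n, (q : ℕ) < p → T.1 q = T'.1 q := fun q hq => ih q hq q rfl
    have hS' : ∀ q : Fin n, (q : ℕ) < p → T'.1 q = T.1 q := fun q hq => (hS q hq).symm
    have h₁ := main hS (h p)
    have h₂ := main hS' (h p).symm
    exact Prod.ext (h p) (by omega)

/-! ### Restriction and extension along the largest entry -/

/-- The cell of the largest entry of a standard filling by `n + 1` entries. [folklore] -/
def lastCell (T : StdFilling (n + 1) Y) : Y.cells :=
  ⟨T.1 (Fin.last n), (YoungDiagram.mem_cells _).2 (T.mem _)⟩

/-- Restricting a standard filling by `n + 1` entries to its first `n` entries gives a standard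
filling of `Y ⊖ c`, `c` the cell of the largest entry (no smaller entry is weakly south-east
of `c`). Fulton, *Young Tableaux*, §7.2. [folklore] -/
def restrict (T : StdFilling (n + 1) Y) {c : ℕ × ℕ} (hc : T.1 (Fin.last n) = c) :
    StdFilling n (Y.removeAbove c) :=
  ⟨fun p => T.1 (Fin.castSucc p),
    ⟨fun p => YoungDiagram.mem_removeAbove.2
        ⟨T.mem _, hc ▸ T.not_le (Fin.castSucc_lt_last p)⟩,
      fun _ _ h => Fin.castSucc_injective _ (T.injective h),
      fun _ _ h => T.not_le (Fin.castSucc_lt_castSucc_iff.2 h)⟩⟩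

/-- Unfolding lemma for `restrict`. [folklore] -/
@[simp]
theorem restrict_apply (T : StdFilling (n + 1) Y) {c : ℕ × ℕ} (hc : T.1 (Fin.last n) = c)
    (p : Fin n) : (restrict T hc).1 p = T.1 (Fin.castSucc p) :=
  rfl

/-- Extending a standard filling of `Y ⊖ c` (`c` a cell of `Y`) by placing the new largest
entry at `c` gives a standard filling of `Y`. Fulton, *Young Tableaux*, §7.2. [folklore] -/
def extend {c : ℕ × ℕ} (hc : c ∈ Y) (T : StdFilling n (Y.removeAbove c)) :
    StdFilling (n + 1) Y :=
  ⟨Fin.snoc T.1 c, by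
    refine ⟨fun p => ?_, fun p q h => ?_, fun p q h => ?_⟩
    · rcases Fin.eq_castSucc_or_eq_last p with ⟨p, rfl⟩ | rfl
      · rw [Fin.snoc_castSucc]
        exact YoungDiagram.mem_of_mem_removeAbove (T.mem p)
      · rwa [Fin.snoc_last]
    · rcases Fin.eq_castSucc_or_eq_last p with ⟨p, rfl⟩ | rfl <;>
        rcases Fin.eq_castSucc_or_eq_last q with ⟨q, rfl⟩ | rfl
      · rw [Fin.snoc_castSucc, Fin.snoc_castSucc] at h
        rw [T.injective h]
      · rw [Fin.snoc_castSucc, Fin.snoc_last] at h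
        exact absurd h.ge (YoungDiagram.mem_removeAbove.1 (T.mem p)).2
      · rw [Fin.snoc_castSucc, Fin.snoc_last] at h
        exact absurd h.le (YoungDiagram.mem_removeAbove.1 (T.mem q)).2
      · rfl
    · rcases Fin.eq_castSucc_or_eq_last p with ⟨p, rfl⟩ | rfl <;>
        rcases Fin.eq_castSucc_or_eq_last q with ⟨q, rfl⟩ | rfl
      · rw [Fin.snoc_castSucc, Fin.snoc_castSucc]
        exact T.not_le (Fin.castSucc_lt_castSucc_iff.1 h)
      · rw [Fin.snoc_castSucc, Fin.snoc_last]
        exact (YoungDiagram.mem_removeAbove.1 (T.mem p)).2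
      · exact absurd h (not_lt.2 (Fin.castSucc_lt_last q).le)
      · exact absurd h (lt_irrefl _)⟩

/-- Unfolding lemma for `extend`. [folklore] -/
@[simp]
theorem extend_val {c : ℕ × ℕ} (hc : c ∈ Y) (T : StdFilling n (Y.removeAbove c)) :
    (extend hc T).1 = Fin.snoc T.1 c :=
  rfl

/-- **The fibre of "cell of the largest entry".** Standard fillings of `Y` by `n + 1` entries
whose largest entry sits in the cell `c` correspond, by restriction, to standard fillings of
`Y ⊖ c` by `n` entries. Fulton, *Young Tableaux*, §7.2; James, LNM 682, §9. [folklore] -/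
def fibreLastCellEquiv (c : Y.cells) :
    {T : StdFilling (n + 1) Y // T.lastCell = c} ≃ StdFilling n (Y.removeAbove c) where
  toFun T := restrict T.1 (congrArg Subtype.val T.2)
  invFun T := ⟨extend ((YoungDiagram.mem_cells _).1 c.2) T, Subtype.ext (by simp [lastCell])⟩
  left_inv T := by
    apply Subtype.ext
    apply StdFilling.ext
    have h : T.1.1 (Fin.last n) = c := congrArg Subtype.val T.2
    rw [extend_val]
    change Fin.snoc (Fin.init T.1.1) (c : ℕ × ℕ) = T.1.1
    rw [← h]
    exact Fin.snoc_init_self _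
  right_inv T := by
    apply StdFilling.ext
    funext p
    simp

/-- **Branching rule for standard fillings.** `#Std_{n+1}(Y) = ∑_{c ∈ Y} #Std_n(Y ⊖ c)`:
sort the standard fillings by the cell of their largest entry. For `n + 1 = |Y|` only the
corners `c` contribute, and this is the classical branching rule `f^λ = ∑_{corners} f^{λ⁻}`.
Fulton, *Young Tableaux*, §7.2 with §5.1; James, LNM 682, 9.2. [folklore] -/
theorem card_stdFilling_succ (n : ℕ) (Y : YoungDiagram) :
    Nat.card (StdFilling (n + 1) Y) =
      ∑ c ∈ Y.cells, Nat.card (StdFilling n (Y.removeAbove c)) := by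
  rw [← Nat.card_congr (Equiv.sigmaFiberEquiv (lastCell (n := n) (Y := Y))), Nat.card_sigma,
    ← Finset.sum_coe_sort Y.cells]
  exact Finset.sum_congr rfl fun c _ => Nat.card_congr (fibreLastCellEquiv c)

/-- There is exactly one standard filling by no entries (the empty tableau; base of the
branching recursion, `f^∅ = 1`). Fulton, *Young Tableaux*, §7.2. [folklore] -/
theorem card_zero (Y : YoungDiagram) : Nat.card (StdFilling 0 Y) = 1 := by
  rw [Nat.card_eq_one_iff_unique]
  exact ⟨⟨fun a b => StdFilling.ext (funext fun p => Fin.elim0 p)⟩,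
    ⟨⟨Fin.elim0, fun p => Fin.elim0 p, fun p => Fin.elim0 p, fun p => Fin.elim0 p⟩⟩⟩

/-- H21's standard fillings `Fin n ≃ Y.cells` (`IsStandardFilling`, file `PartitionTableaux`)
are the standard fillings by `n = |Y|` entries of this file. [folklore] -/
noncomputable def equivStandardFilling (hn : Y.cells.card = n) :
    {f : Fin n ≃ Y.cells // IsStandardFilling Y f} ≃ StdFilling n Y where
  toFun f := ⟨fun p => (f.1 p : ℕ × ℕ),
    ⟨fun p => (YoungDiagram.mem_cells _).1 (f.1 p).2,
      Subtype.val_injective.comp f.1.injective, fun p q h => f.2 p q h⟩⟩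
  invFun T := ⟨Equiv.ofBijective _ (T.bijective hn), fun p q h => T.not_le h⟩
  left_inv f := by
    apply Subtype.ext
    apply Equiv.ext
    intro p
    rfl
  right_inv T := rfl

end StdFilling

/-- **`f^μ` counts standard fillings.** The number of standard Young tableaux of shape `μ ⊢ d`
(`numStandardTableaux`, bijective fillings `Fin d ≃ cells`) is the number of standard fillings
of `μ.youngDiagram` by `d` entries. Fulton, *Young Tableaux*, §7.2. [folklore] -/
theorem numStandardTableaux_eq_card_stdFilling {d : ℕ} (μ : Nat.Partition d) :
    numStandardTableaux μ = Nat.card (StdFilling d μ.youngDiagram) :=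
  Nat.card_congr (StdFilling.equivStandardFilling μ.card_cells_youngDiagram)

end CplxAlg

end Literature.NumberTheory.DiophantineGeometry
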